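/-
Copyright (c) 2026. All rights reserved.
Released under Apache 2.0 license as described in the file LICENSE.
-/
import Literature.Probability.FitznerVanDerHofstad2017.NobleBoundsNDispatchStarL
import Literature.Probability.FitznerVanDerHofstad2017.NobleBoundsNMidF1
import Literature.Probability.FitznerVanDerHofstad2017.NobleBoundsNEndC1
import HarnessLib

/-!
# Fitzner–van der Hofstad (2017), general `N`: variant `F′` over a CLOSED lower level (the `hF1★` cells)

[FvdH17] R. Fitzner, R. van der Hofstad, *Mean-field behavior for nearest-neighbor percolation in `d > 10`*,
Electron. J. Probab. **22** (2017) no. 43, arXiv:1506.07977v2: §6.1 (6.4) and "Case a ≥ 2" × "Case b = 0 / 1 /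
≥ 2" (pp. 58–59), §5.1 (5.4) second term (p. 48), (4.59)–(4.65) (pp. 41–43), App. B (p. 75).

A middle junction `k = i₀ + 1 ≤ M` whose lower level `k` is CLOSED (`a_k = ★`) and whose upper level `k + 1` is a
`midE` level of variant `F′` (kind bit `true`, `a_{k+1} = a′` regular, `t_k = u_{k+1}`): the second term of the
pointwise block (5.4) on the pinned section `z_k = w_k`.  The lower level is pinned (`JFacts.pin_closedL`) and owns
no active slot (`jClosedL_not_act_lo`), so — exactly as in `NobleBoundsNLowStar` for variant `F‴` — its cross
letter is read as over a class-`2` level, the line `{t_k ↔ w_k}` being trivially witnessed (`z_k = t_k = w_k`); the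
upper readings are those of `NobleBoundsNMidF1` verbatim (they never used the lower class).

* §A `JFacts.lowF1_facts` (the parameter facts of a non-empty piece), the letter readings `junF_lowF1_xb_le₃ / _le₂`
  and the core `nonempty_jPkg_lowF1_core` (twin of `nonempty_jPkg_midF1_core` without the exit slot);
* §B the cells `nonempty_jPkg_lowF1_zero' / _one / _two` (upper exit class `a′ = 0 / 1 / 2`; targets
  `A'^{κ,2,0}` / `A^{κ,2,1}` / `A^{κ,2,2}(u_k,w_k,w_{k+1},t_k)`), the wrapper `nonempty_jPkg_lowF1'` and the literal
  second-term shape `nonempty_jPkg_lowF1_term₂'`;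
* §C `nonempty_jPkg_lowF1_slot` — the discharge of the slot `hF1` of
  `NobleBoundsNDispatchStarL.nonempty_jPkg_mid_starL` in its literal shape (target `tgtStarL (Letters.perc d p) κ a′ … (τ i)` under
  `(τ i).1 = true`, `(τ i).2 = 0`, `t_k = u_{k+1}`).

Conventions: `d`-generic; nothing is cited as a fact; additive (no existing declaration is changed).
-/

noncomputable section

open scoped ENNReal

namespace Literature.Probability.FitznerVanDerHofstad2017

open Literature.Barriers.CriticalPhenomena Literature.Probability.Percolation
open Literature.Probability.LatticeModels Literature.Combinatorics.SimpleGraph _root_.SimpleGraph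
open _root_.MeasureTheory
open Literature.Probability.FitznerVanDerHofstad2017.NobleBlocks
open Literature.Probability.FitznerVanDerHofstad2017.NobleBlocks.LenIdx

variable {d : ℕ}

/-! ### A. Facts, letter readings and the core over a closed lower level -/

section Facts

variable (M : ℕ) (x : Site d) (b : Fin (M + 2) → Site d × Site d) (w t z : Fin (M + 2) → Site d)
  (a : Fin (M + 2) → Fin 3 ⊕ Unit) (c : Fin 3 ⊕ Unit) (τ : Fin (M + 1) → Bool × Fin 3)

/-- The PARAMETER FACTS of a non-empty `F′` piece at a junction `k` over a closed level `k`, read off `JFacts`: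
`z_k = t_k`, `u_k ∉ {t_k, w_{k+1}}`, `v_k ≠ t_k` ((4.64) on a closed level), and the exit class of level `k + 1`
versus the parameters.  Twin of `midF1_facts` (the two lower-class clauses dropped).
[cite: FitznerVanDerHofstad2017, (4.59), (4.64) and §6.1 "Case b" (arXiv:1506.07977v2 pp. 41–42, 58–59)] -/
theorem JFacts.lowF1_facts {ω : Fin (M + 3) → BondConfig (Site d)} {K₀ : Fin (M + 3) → Fin 6 → Set (Sym2 (Site d))}
    (hF : JFacts M x b w t z a c τ ω K₀) (i i₀ : Fin (M + 1)) (hk : i₀.succ = i.castSucc) (hσ : (τ i).1 = true)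
    {u₀ : Unit} {a' : Fin 3} (ha : a i.castSucc = Sum.inr u₀) (ha' : a i.succ = Sum.inl a')
    (hty : t i.castSucc = (b i.succ).1) :
    z i.castSucc = t i.castSucc ∧ (b i.castSucc).1 ≠ t i.castSucc ∧ (b i.castSucc).1 ≠ w i.succ ∧
      (b i.castSucc).2 ≠ t i.castSucc ∧ (a' = 0 → w i.succ = t i.castSucc) ∧ (a' ≠ 0 → w i.succ ≠ t i.castSucc) ∧
      (a' = 1 → (zdGraph d).Adj (w i.succ) (t i.castSucc)) ∧ (a' = 2 → s(w i.succ, t i.castSucc) ∉ ω i.castSucc.succ) := by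
  have hzt := hF.z_eq_t_of_midE_of_t_eq i hσ ha' hty
  have hv := hF.vac_midE i hσ ha'
  refine ⟨hzt, fun h => hv (by simp [h]), fun h => hv (by simp [h]), ?_, ?_, ?_, ?_, ?_⟩
  · rw [← hzt]; exact hF.v_ne_z_of_closedL i i₀ hk ha
  · intro h0; rw [hty]; exact hF.w_eq_of_exitClass_zero i.succ (ha'.trans (by rw [h0]))
  · intro h0; rw [hty]; exact (hF.u_ne_w_of_exitClass_ne_zero i.succ ha' h0).symm
  · intro h1; rw [hty]; exact ((hF.exitClass_one i.succ (ha'.trans (by rw [h1]))).2.2).symm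
  · intro h2
    have h := (hF.exitClass_two i.succ (ha'.trans (by rw [h2]))).2
    rw [hty, Sym2.eq_swap, Fin.succ_castSucc]
    exact h

end Facts

section Letter

variable (p : unitInterval) (M : ℕ) (x : Site d) (b : Fin (M + 2) → Site d × Site d) (w t z : Fin (M + 2) → Site d)
  (a : Fin (M + 2) → Fin 3 ⊕ Unit) (τ : Fin (M + 1) → Bool × Fin 3)

/-- **Three-line reading of the term-2 letter over a closed lower level**: bond (level `k`), `v → w′`, `w′ → t`
(level `k + 1`); the lower level contributes no line. [cite: FitznerVanDerHofstad2017, §4.2 (4.18) (arXiv:1506.07977v2 p. 35); §6.1 (6.4) (p. 58)] -/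
theorem junF_lowF1_xb_le₃ (i : Fin (M + 1)) (hσ : (τ i).1 = true) {a' : Fin 3} (ha' : a i.succ = Sum.inl a')
    (EB E0 E1 X5 : Set (BondConfig (Site d))) :
    junF p M x b w t z a τ i.castSucc glMidS1 true false (midF1Ev EB E0 E1 X5) .xb ≤
      piPerc d p 2 (genDisjOcc ![EB, E0, E1] ![0, 1, 1]) := by
  refine junF_le_of_lines p M x b w t z a τ i.castSucc glMidS1 true false _ JIdx.xb
    ![JIdx.xb, .up 0, .up 1] (by decide) (fun m => ?_) ![0, 1, 1] (fun m => by fin_cases m <;> rfl)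
    ![EB, E0, E1] (by funext m; fin_cases m <;> rfl)
  fin_cases m
  · exact ⟨rfl, rfl⟩
  · exact ⟨(jMidE_act_up_iff M x b w t z a τ i hσ ha' true false 0).2 (by decide), rfl⟩
  · exact ⟨(jMidE_act_up_iff M x b w t z a τ i hσ ha' true false 1).2 (by decide), rfl⟩

/-- **Two-line reading, slot `1` dropped** (row `a′ = 0`: `w′ = t`, the class-`a′` leg is trivial).
[cite: FitznerVanDerHofstad2017, §4.2 (4.18) (arXiv:1506.07977v2 p. 35); §6.1 (6.4) (p. 58)] -/
theorem junF_lowF1_xb_le₂ (i : Fin (M + 1)) (hσ : (τ i).1 = true) {a' : Fin 3} (ha' : a i.succ = Sum.inl a')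
    (EB E0 E1 X5 : Set (BondConfig (Site d))) :
    junF p M x b w t z a τ i.castSucc glMidS1 true false (midF1Ev EB E0 E1 X5) .xb ≤
      piPerc d p 2 (genDisjOcc ![EB, E0] ![0, 1]) := by
  refine junF_le_of_lines p M x b w t z a τ i.castSucc glMidS1 true false _ JIdx.xb
    ![JIdx.xb, .up 0] (by decide) (fun m => ?_) ![0, 1] (fun m => by fin_cases m <;> rfl)
    ![EB, E0] (by funext m; fin_cases m <;> rfl)
  fin_cases m
  · exact ⟨rfl, rfl⟩
  · exact ⟨(jMidE_act_up_iff M x b w t z a τ i hσ ha' true false 0).2 (by decide), rfl⟩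

variable (c : Fin 3 ⊕ Unit)

/-- **The core of every term-2 package over a closed lower level**: finitary events `E0 ⊇` the witness of
`v → w′`, `E1 ⊇` the witness of `w′ → t` (on the piece) and a bound of the single genuine letter `xb` = {bond,
`v → w′`, `w′ → t`} by the target give a package; the closed lower level owns no active slot
(`jClosedL_not_act_lo`), the loop slots `2, 3, 4` of the `midE` level form a letter bounded by `1`.  Twin of
`nonempty_jPkg_midF1_core`.
[cite: FitznerVanDerHofstad2017, §6.1 (6.4) (arXiv:1506.07977v2 p. 58); §4.4 (4.57)–(4.61), (4.65) (pp. 41, 43)] -/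
theorem nonempty_jPkg_lowF1_core (i i₀ : Fin (M + 1)) (hk : i₀.succ = i.castSucc) (κ : Fin d × Bool)
    (hb : (b i.castSucc).2 = (b i.castSucc).1 + stepVec κ) (hσ : (τ i).1 = true) {u₀ : Unit} {a' : Fin 3}
    (ha : a i.castSucc = Sum.inr u₀) (ha' : a i.succ = Sum.inl a') (E0 E1 : Set (BondConfig (Site d)))
    (h0 : IsFinitary E0) (h1 : IsFinitary E1)
    (hmem : ∀ ω K₀, JFacts M x b w t z a c τ ω K₀ → K₀ i.castSucc.succ 0 ∈ E0 ∧ K₀ i.castSucc.succ 1 ∈ E1)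
    {tgt : ℝ≥0∞}
    (hrow : junF p M x b w t z a τ i.castSucc glMidS1 true false
      (midF1Ev (event (eq 1) (b i.castSucc).1 (b i.castSucc).2) E0 E1 Set.univ) .xb ≤ tgt) :
    Nonempty (JPkg p (jctx M x b w t z a τ i.castSucc) (JFacts M x b w t z a c τ) tgt) := by
  have huv : (b i.castSucc).1 ≠ (b i.castSucc).2 := by
    rw [hb]; exact (zdGraph_adj_iff_stepVec _ _ |>.2 ⟨κ, rfl⟩).ne
  refine nonempty_jPkg_of_joint p i.castSucc glMidS1 true
    (midF1Ev (event (eq 1) (b i.castSucc).1 (b i.castSucc).2) E0 E1 Set.univ)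
    (isFinitary_midEv _ _ _ _ _ _ _ (isFinitary_event _ _ _) h0 h1 isFinitary_univ isFinitary_univ
      isFinitary_univ isFinitary_univ)
    (fun _ => by rw [midF1Ev, midEv_xb]; exact singleton_mem_event_eq_one huv)
    (fun j j' _ _ hg => glMidS1_entry_midE M x b w t z a τ i hσ ha' j j' hg)
    (fun ω K₀ hF => ⟨fun j hj => ?_, fun j hj => ?_⟩) ?_
  · -- a closed lower level owns no active slot
    exact absurd hj (jClosedL_not_act_lo M x b w t z a τ i i₀ hk ha true false j)
  · -- the witnesses of level `k + 1`
    have hj5 : j ≠ 5 := (jMidE_act_up_iff M x b w t z a τ i hσ ha' true false j).1 hj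
    exact mem_midEv_up _ _ _ _ _ _ _ (hmem ω K₀ hF).1 (hmem ω K₀ hF).2 (Set.mem_univ _) (Set.mem_univ _)
      (Set.mem_univ _) j hj5
  · -- one genuine letter
    refine (prod_junF_le₂ p M x b w t z a τ i.castSucc glMidS1 true false _
      (show JIdx.xb ≠ JIdx.up 2 by decide)).trans ?_
    refine (mul_le_mul' hrow (junF_le_one p M x b w t z a τ i.castSucc glMidS1 true false _ _)).trans ?_
    rw [mul_one]

end Letter

/-! ### B. The three cells and the term-2 shapes -/

section Packages

variable (p : unitInterval) (M : ℕ) (x : Site d) (b : Fin (M + 2) → Site d × Site d) (w t z : Fin (M + 2) → Site d)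
  (a : Fin (M + 2) → Fin 3 ⊕ Unit) (c : Fin 3 ⊕ Unit) (τ : Fin (M + 1) → Bool × Fin 3)


/-- **Cell `(★, F′, a′ = 0)`** of a middle junction `k = i₀ + 1 ≤ M` over a closed level, on the pin `z_k = w_k`:
a package with target `A'^{κ,2,0}(u_k, w_k, w_{k+1}, t_k)` — exit class `0` of level `k + 1` identifies
`w_{k+1} = u_{k+1} = t_k (= z_k = w_k)`, so the letter is the bond and `{v ←1→ t}` with the trivially witnessed
`{t ↔ w}`.
[cite: FitznerVanDerHofstad2017, §6.1 (6.4), "Case a ≥ 2", "Case b = 0" (arXiv:1506.07977v2 pp. 58–59); §5.1 (5.4) second term (p. 48); App. B row a ≥ 2, b = 0 (p. 75)] -/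
theorem nonempty_jPkg_lowF1_zero' (i i₀ : Fin (M + 1)) (hk : i₀.succ = i.castSucc) (κ : Fin d × Bool)
    (hb : (b i.castSucc).2 = (b i.castSucc).1 + stepVec κ) (hσ : (τ i).1 = true) {u₀ : Unit}
    (ha : a i.castSucc = Sum.inr u₀) (ha' : a i.succ = Sum.inl 0) (hzw : z i.castSucc = w i.castSucc)
    (hty : t i.castSucc = (b i.succ).1) :
    Nonempty (JPkg p (jctx M x b w t z a τ i.castSucc) (JFacts M x b w t z a c τ)
      (blockAiota' (Letters.perc d p) κ 2 0 (b i.castSucc).1 (w i.castSucc) (w i.succ) (t i.castSucc))) := by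
  -- degenerate parameters: the piece is empty
  by_cases hP : z i.castSucc = t i.castSucc ∧ (b i.castSucc).2 ≠ t i.castSucc ∧ w i.succ = t i.castSucc
  swap
  · refine ⟨JPkg.vacuous p _ _ (fun ω K₀ hF => hP ?_) _⟩
    obtain ⟨hzt, -, -, hvt, hw0, -⟩ := hF.lowF1_facts M x b w t z a c τ i i₀ hk hσ ha ha' hty
    exact ⟨hzt, hvt, hw0 rfl⟩
  obtain ⟨hzt, hvt, hw'⟩ := hP
  have htw : t i.castSucc = w i.castSucc := hzt.symm.trans hzw
  rw [hw', blockAiota'_of_ne (Letters.perc d p) κ (a := 2) (b := 0) fun h => absurd h.1 (by decide)]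
  refine nonempty_jPkg_lowF1_core p M x b w t z a τ c i i₀ hk κ hb hσ ha ha'
    (event (ge 1) (b i.castSucc).2 (t i.castSucc)) Set.univ (isFinitary_event _ _ _) isFinitary_univ
    (fun ω K₀ hF => ⟨?_, Set.mem_univ _⟩) ?_
  · -- entry line `v → w′ = t`, non-trivial
    obtain ⟨h0, -⟩ := hF.conn_midE i hσ ha'
    rw [hw'] at h0
    rw [event_ge]; exact mem_openConnGe_one_of_ne h0 hvt
  · -- the letter: bond, `v → t` (+ the trivially witnessed `t ↔ w`)
    refine (junF_lowF1_xb_le₂ p M x b w t z a τ i hσ ha' _ _ _ _).trans ?_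
    refine (measure_mono (genDisjOcc_pair_subset_triple _ _ (event (ge 0) (t i.castSucc) (w i.castSucc))
      (by rw [htw]; exact empty_mem_event_ge_zero_self (w i.castSucc)) 0 1 0)).trans ?_
    exact piPerc_midF1_two_zero_le_blockAiota p hb ![0, 1, 0]

/-- **Cell `(★, F′, a′ = 1)`** over a closed level, on the pin `z_k = w_k`: a package with target
`A^{κ,2,1}(u_k, w_k, w_{k+1}, t_k)` — exit class `1` of level `k + 1` makes `{w_{k+1}, u_{k+1} = t_k}` an open
bond, which IS the witness of `w′ → t` (normal form (10), `JFacts.wit_one_midF1`); letter: bond, `{v ↔ w′}`,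
`{w′ ←1̲→ t}` and the trivially witnessed `{t ↔ w}`.
[cite: FitznerVanDerHofstad2017, §6.1 (6.4), "Case a ≥ 2", "b = 1" (arXiv:1506.07977v2 pp. 58–59); §5.1 (5.4) second term (p. 48); App. B row a ≥ 2, b = 1 (p. 75)] -/
theorem nonempty_jPkg_lowF1_one (i i₀ : Fin (M + 1)) (hk : i₀.succ = i.castSucc) (κ : Fin d × Bool)
    (hb : (b i.castSucc).2 = (b i.castSucc).1 + stepVec κ) (hσ : (τ i).1 = true) {u₀ : Unit}
    (ha : a i.castSucc = Sum.inr u₀) (ha' : a i.succ = Sum.inl 1) (hzw : z i.castSucc = w i.castSucc)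
    (hty : t i.castSucc = (b i.succ).1) :
    Nonempty (JPkg p (jctx M x b w t z a τ i.castSucc) (JFacts M x b w t z a c τ)
      (blockAiota (Letters.perc d p) κ 2 1 (b i.castSucc).1 (w i.castSucc) (w i.succ) (t i.castSucc))) := by
  -- degenerate parameters: the piece is empty
  by_cases hP : z i.castSucc = t i.castSucc ∧ w i.succ ≠ t i.castSucc
  swap
  · refine ⟨JPkg.vacuous p _ _ (fun ω K₀ hF => hP ?_) _⟩
    obtain ⟨hzt, -, -, -, -, hw', -⟩ := hF.lowF1_facts M x b w t z a c τ i i₀ hk hσ ha ha' hty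
    exact ⟨hzt, hw' (by decide)⟩
  obtain ⟨hzt, hw't⟩ := hP
  have htw : t i.castSucc = w i.castSucc := hzt.symm.trans hzw
  refine nonempty_jPkg_lowF1_core p M x b w t z a τ c i i₀ hk κ hb hσ ha ha'
    (event (ge 0) (b i.castSucc).2 (w i.succ)) (event (eq 1) (w i.succ) (t i.castSucc))
    (isFinitary_event _ _ _) (isFinitary_event _ _ _) (fun ω K₀ hF => ⟨?_, ?_⟩) ?_
  · obtain ⟨h0, -⟩ := hF.conn_midE i hσ ha'
    rw [event_ge]; exact mem_openConnGe_zero_of_mem h0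
  · -- the witness of `w′ → t` is the open bond itself
    rw [hF.wit_one_midF1 i hσ ha' hty, ← hty]
    exact singleton_mem_event_eq_one hw't
  · -- the letter: bond, `v → w′`, the open bond (+ the trivially witnessed `t ↔ w`)
    refine (junF_lowF1_xb_le₃ p M x b w t z a τ i hσ ha' _ _ _ _).trans ?_
    refine (measure_mono (genDisjOcc_triple_subset_quad _ _ _ (event (ge 0) (t i.castSucc) (w i.castSucc))
      (by rw [htw]; exact empty_mem_event_ge_zero_self (w i.castSucc)) 0 1 1 0)).trans ?_
    exact piPerc_midF1_two_one_le_blockAiota p hb ![0, 1, 1, 0]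

/-- **Cell `(★, F′, a′ = 2)`** over a closed level, on the pin `z_k = w_k`: a package with target
`A^{κ,2,2}(u_k, w_k, w_{k+1}, t_k)` — exit class `2` of level `k + 1` upgrades `w′ → t = u_{k+1}` to `{w′ ←2→ t}`
(the bond, if any, is not open on level `k + 1`); letter: bond, `{v ↔ w′}`, `{w′ ←2→ t}` and the trivially
witnessed `{t ↔ w}`.
[cite: FitznerVanDerHofstad2017, §6.1 (6.4), "Cases a ≥ 1 and b ≥ 1", "b ≥ 2" (arXiv:1506.07977v2 pp. 58–59); §5.1 (5.4) second term (p. 48); App. B row a ≥ 2, b ≥ 2 (p. 75)] -/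
theorem nonempty_jPkg_lowF1_two (i i₀ : Fin (M + 1)) (hk : i₀.succ = i.castSucc) (κ : Fin d × Bool)
    (hb : (b i.castSucc).2 = (b i.castSucc).1 + stepVec κ) (hσ : (τ i).1 = true) {u₀ : Unit}
    (ha : a i.castSucc = Sum.inr u₀) (ha' : a i.succ = Sum.inl 2) (hzw : z i.castSucc = w i.castSucc)
    (hty : t i.castSucc = (b i.succ).1) :
    Nonempty (JPkg p (jctx M x b w t z a τ i.castSucc) (JFacts M x b w t z a c τ)
      (blockAiota (Letters.perc d p) κ 2 2 (b i.castSucc).1 (w i.castSucc) (w i.succ) (t i.castSucc))) := by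
  -- degenerate parameters: the piece is empty
  by_cases hP : z i.castSucc = t i.castSucc ∧ w i.succ ≠ t i.castSucc
  swap
  · refine ⟨JPkg.vacuous p _ _ (fun ω K₀ hF => hP ?_) _⟩
    obtain ⟨hzt, -, -, -, -, hw', -⟩ := hF.lowF1_facts M x b w t z a c τ i i₀ hk hσ ha ha' hty
    exact ⟨hzt, hw' (by decide)⟩
  obtain ⟨hzt, hw't⟩ := hP
  have htw : t i.castSucc = w i.castSucc := hzt.symm.trans hzw
  refine nonempty_jPkg_lowF1_core p M x b w t z a τ c i i₀ hk κ hb hσ ha ha'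
    (event (ge 0) (b i.castSucc).2 (w i.succ)) (event (ge 2) (w i.succ) (t i.castSucc))
    (isFinitary_event _ _ _) (isFinitary_event _ _ _) (fun ω K₀ hF => ⟨?_, ?_⟩) ?_
  · obtain ⟨h0, -⟩ := hF.conn_midE i hσ ha'
    rw [event_ge]; exact mem_openConnGe_zero_of_mem h0
  · -- `w′ → t` of length `≥ 2`: the bond is not open on level `k + 1`
    obtain ⟨-, h1, -⟩ := hF.conn_midE i hσ ha'
    have hcl := (hF.lowF1_facts M x b w t z a c τ i i₀ hk hσ ha ha' hty).2.2.2.2.2.2.2 rfl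
    rw [event_ge]
    exact mem_openConnGe_two_of_notMem h1 hw't fun hm => hcl (hF.witness_subset _ 1 hm)
  · -- the letter: bond, `v → w′`, `w′ ⇐2⇒ t` (+ the trivially witnessed `t ↔ w`)
    refine (junF_lowF1_xb_le₃ p M x b w t z a τ i hσ ha' _ _ _ _).trans ?_
    refine (measure_mono (genDisjOcc_triple_subset_quad _ _ _ (event (ge 0) (t i.castSucc) (w i.castSucc))
      (by rw [htw]; exact empty_mem_event_ge_zero_self (w i.castSucc)) 0 1 1 0)).trans ?_
    exact piPerc_midF1_two_two_le_blockAiota p hb ![0, 1, 1, 0]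

/-- **The three cells `(★, F′, a′)` against the primed family**: a package with target
`A'^{κ,2,a′}(u_k, w_k, w_{k+1}, t_k)` (`= A^{κ,2,a′}`: entry class `2 ≠ 0`).
[cite: FitznerVanDerHofstad2017, §6.1 (6.4) and "Case a ≥ 2" × "Case b" (arXiv:1506.07977v2 pp. 58–59); §5.1 (5.4) (p. 48); App. B (p. 75)] -/
theorem nonempty_jPkg_lowF1' (i i₀ : Fin (M + 1)) (hk : i₀.succ = i.castSucc) (κ : Fin d × Bool)
    (hb : (b i.castSucc).2 = (b i.castSucc).1 + stepVec κ) (hσ : (τ i).1 = true) {u₀ : Unit} (a' : Fin 3)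
    (ha : a i.castSucc = Sum.inr u₀) (ha' : a i.succ = Sum.inl a') (hzw : z i.castSucc = w i.castSucc)
    (hty : t i.castSucc = (b i.succ).1) :
    Nonempty (JPkg p (jctx M x b w t z a τ i.castSucc) (JFacts M x b w t z a c τ)
      (blockAiota' (Letters.perc d p) κ 2 a' (b i.castSucc).1 (w i.castSucc) (w i.succ) (t i.castSucc))) := by
  have h3 : ∀ e : Fin 3, e = 0 ∨ e = 1 ∨ e = 2 := by decide
  rcases h3 a' with h0 | h1 | h2
  · subst h0
    exact nonempty_jPkg_lowF1_zero' p M x b w t z a c τ i i₀ hk κ hb hσ ha ha' hzw hty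
  · subst h1
    rw [blockAiota'_of_ne (Letters.perc d p) κ (a := 2) (b := 1) fun h => absurd h.1 (by decide)]
    exact nonempty_jPkg_lowF1_one p M x b w t z a c τ i i₀ hk κ hb hσ ha ha' hzw hty
  · subst h2
    rw [blockAiota'_of_ne (Letters.perc d p) κ (a := 2) (b := 2) fun h => absurd h.1 (by decide)]
    exact nonempty_jPkg_lowF1_two p M x b w t z a c τ i i₀ hk κ hb hσ ha ha' hzw hty

/-- **The cells `(★, F′, a′)` in the literal shape of the second term of (5.4)**: target
`δ_{z_k,t_k} (A'^{κ,2,a′}(u_k,w_k,w_{k+1},t_k) · P^{S,0}(u_{k+1}−t_k, u_{k+1}−t_k))` (`z_k ≠ t_k` is vacuous on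
`F′`, and `P^{S,0}(0,0) = 1`).  Twin of `nonempty_jPkg_midF1_term₂'`.
[cite: FitznerVanDerHofstad2017, §5.1 (5.4) second term (arXiv:1506.07977v2 p. 48); §6.1 (6.4) (p. 58); App. B (pp. 73, 75)] -/
theorem nonempty_jPkg_lowF1_term₂' (i i₀ : Fin (M + 1)) (hk : i₀.succ = i.castSucc) (κ : Fin d × Bool)
    (hb : (b i.castSucc).2 = (b i.castSucc).1 + stepVec κ) (hσ : (τ i).1 = true) {u₀ : Unit} (a' : Fin 3)
    (ha : a i.castSucc = Sum.inr u₀) (ha' : a i.succ = Sum.inl a') (hzw : z i.castSucc = w i.castSucc)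
    (hty : t i.castSucc = (b i.succ).1) :
    Nonempty (JPkg p (jctx M x b w t z a τ i.castSucc) (JFacts M x b w t z a c τ)
      (kd (z i.castSucc) (t i.castSucc) *
        (blockAiota' (Letters.perc d p) κ 2 a' (b i.castSucc).1 (w i.castSucc) (w i.succ) (t i.castSucc) *
          blockPS (Letters.perc d p) 0 ((b i.succ).1 - t i.castSucc) ((b i.succ).1 - t i.castSucc)))) := by
  by_cases hzt : z i.castSucc = t i.castSucc
  · rw [hzt, kd_self, one_mul, ← hty, sub_self, blockPS_zero_origin, mul_one]
    exact nonempty_jPkg_lowF1' p M x b w t z a c τ i i₀ hk κ hb hσ a' ha ha' hzw hty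
  · exact nonempty_jPkg_of_midE_t_eq_z_ne p M x b w t z a c τ _ i hσ ha' hty hzt _

/-! ### C. The slot `hF1` of `nonempty_jPkg_mid_starL`, discharged -/

/-- **The `F′` slot of the lower-`★` dispatcher, discharged**: for a middle junction `k = i₀ + 1 ≤ M` over a closed
level with a regular upper class `a′`, kind bit `true`, inner class `0` and `t_k = u_{k+1}`, a package with target
`tgtStarL (Letters.perc d p) κ a′ (u_k,w_k,t_k,z_k,w_{k+1},u_{k+1}) (τ i)` — off the pin `z_k = w_k` the piece is empty
(`nonempty_jPkg_of_closedL_of_ne`), on it the target is the second term of (5.4) (`tgtReg_true_zero`) and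
`nonempty_jPkg_lowF1_term₂'` pays.  This is literally the hypothesis `hF1` of
`NobleBoundsNDispatchStarL.nonempty_jPkg_mid_starL`.
[cite: FitznerVanDerHofstad2017, §6.1 (6.4) and "Case a ≥ 2" × "Case b" (arXiv:1506.07977v2 pp. 58–59); §5.1 (5.4) second term (p. 48); App. B (p. 75)] -/
theorem nonempty_jPkg_lowF1_slot (i i₀ : Fin (M + 1)) (hk : i₀.succ = i.castSucc) (κ : Fin d × Bool)
    (hb : (b i.castSucc).2 = (b i.castSucc).1 + stepVec κ) {u₀ : Unit} (ha : a i.castSucc = Sum.inr u₀)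
    (a' : Fin 3) (ha' : a i.succ = Sum.inl a') (hσ : (τ i).1 = true) (hc : (τ i).2 = 0)
    (hty : t i.castSucc = (b i.succ).1) :
    Nonempty (JPkg p (jctx M x b w t z a τ i.castSucc) (JFacts M x b w t z a c τ)
      (tgtStarL (Letters.perc d p) κ a' (b i.castSucc).1 (w i.castSucc) (t i.castSucc) (z i.castSucc) (w i.succ) (b i.succ).1
        (τ i))) := by
  by_cases hzw : z i.castSucc = w i.castSucc
  swap
  · exact nonempty_jPkg_of_closedL_of_ne p M x b w t z a c τ i i₀ hk ha hzw _
  have hv : τ i = (true, 0) := Prod.ext hσ hc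
  rw [tgtStarL_of_eq (Letters.perc d p) κ a' _ _ _ _ _ _ hzw, hv, tgtReg_true_zero]
  exact nonempty_jPkg_lowF1_term₂' p M x b w t z a c τ i i₀ hk κ hb hσ a' ha ha' hzw hty

end Packages

end Literature.Probability.FitznerVanDerHofstad2017

end
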